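/-
Copyright (c) 2026 the pub-hodgecm-mathlib formalisation cell (harness21).  Prover seat hodgecm-mathlib-F0P2-p06 (g22): E1 row 61-G «BLOCK MULTIPLICITY ON THE TREE» (the generic
composition ★ row 60 ∘ ★ (M3) ∘ ★ (M2) between the per-type wrapper and the Bruhat–Tits datum; E1 keeper ∕ dealer F0P3a-p03 (g30) «= cut» 04:35:49Z), 2026-09-03.
-/
import Literature.NumberTheory.Automorphic.SchneiderStuhlerEPInducedTracePerType      -- ★ row 60: `finrank_intertwiningMap_smoothIndRep_eq_sum_finrank_block_eigen`
import Literature.NumberTheory.Automorphic.SchneiderStuhlerEPInducedTraceLocalData     -- ★ (M3): `exists_mackeyLocalData`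
import Literature.NumberTheory.Automorphic.SchneiderStuhlerTreeLocalModel             -- ★ (M2): `exists_localModels_zeroBlocks∕oneBlocks`, `exists_stabilizer_subgroups`, `exists_monoidHoms_of_coe_mem`, `exists_restrict_blockData`
import Literature.NumberTheory.Automorphic.SchneiderStuhlerTreeJacquetEulerIsotypic    -- ★ 5b: `mapEdgeSet_mul`, `mapEdgeSet_one` (and the currency of the conclusion)
import HarnessLib

/-!
# The blockwise multiplicity of a `K`-type in an induced representation, on the tree

Topic `NumberTheory/Automorphic`; namespace `Representation`; THEOREMS ONLY (no definition, instance, notation or named fact); imports ★ row 60, ★ (M3), ★ (M2), ★ 5b, HarnessLib.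
Cell `pub/hodgecm-mathlib` (D-0151), crux H413 = `stmt-HodgeConjecture-24833`, lane `--supports`; E1 row 61-G.  Count-neutral generic base layer; HC_CM is proved only modulo the
7 printed citations (2 remaining named inputs: hLiu418 = `stmt-HodgeConjecture-24832`, h413 = `stmt-HodgeConjecture-24833`) until rung 0 closes.

THE COMPOSITION.  ★ row 60 `finrank_intertwiningMap_smoothIndRep_eq_sum_finrank_block_eigen` writes `dim Hom_K(E, (Ind_{P}^Γ σ)|_K)` as a sum of Jacquet–eigen block terms
`Σ_j dim ([W_{r j}] ⊓ E_N)` but is hypothesis-style in ≈ 40 representation-side letters (`σc τ′ σT σQ χ σtw Eig`, `τM Blk act`, `emb Nr φN`, `cj TM Tc χ′ EN`, …).  For `Γ` acting on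
a tree `X` with vertex groups `U_x` (`hUa`), a smooth `ρ` with finite-dimensional `V^{U_x}`, the chain representations of ★ FILE 5a (`hτ hρ₀` ∕ `hτ₁ hρ₁`), a parabolic triple
`t = (P, M, N)` and an inducing LINE `σ = χH` on `W` (`hσχ hχo hNχ hW1`), this file PLUGS IN ★ (M3) `exists_mackeyLocalData` (the local representation data), ★ (M2)
`exists_localModels_zeroBlocks∕oneBlocks` + `exists_stabilizer_subgroups` + `exists_monoidHoms_of_coe_mem` + `exists_restrict_blockData` (the local models and the `N ≤ P`
dictionary), leaving EXACTLY the geometric binders of the Bruhat–Tits datum, each in the currency in which ★ 55-B (`F0P3cStCharTSHorocycleDataAtDatum`,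
`F0P3cStCharTSBorelDoubleCosetsAtDatum`) serves it:
* (X3)(X4) ONE (α) double-coset package at the facet stabiliser `K`: representatives `g : κι → Γ`, `hcover hdisj`, `T i = P ∩ g_i K g_i⁻¹` (`hT`), the compact torus `C ≤ M` read in
  every `T i` (`hCT`, `C.subgroupOf (T i)`), `hdec` (`T i = C · (N ∩ T i)`), `hC`;
* (X1) the horocycle representative ∕ transporter data of the facets (`rep tr htrN htr hrep_act hrep_id`, ★ 5b's letters) and `hr : g_i · F ∈ R`;
* (X2)∕(L2) the torus character `χC = χH|_C` (`hχC`) and its eigenspace `E_q` in the Jacquet module of `C_q(X)` (`hE_q`, ★ 5b's letters VERBATIM).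
* §1 **`finrank_intertwiningMap_smoothIndRep_eq_sum_block_eigen_zeroChains`** (a VERTEX `x₀`, `K = Stab(x₀)`, `E = V^{U_{x₀}}`):
  `dim Hom_K(V^{U_{x₀}}, (Ind_P^Γ σ)|_K) = Σ_i dim ([W⁰_{g_i x₀}] ⊓ E₀)`, the summand being ★ 5b's vertex term at `r = g_i · x₀`.
* §2 **`finrank_intertwiningMap_smoothIndRep_eq_sum_block_eigen_oneChains`** (an EDGE `b₀`, `K = Stab(b₀)`, `E = V^{U_{head} ⊔ U_{tail}}`): the same with ★ 5b's edge term.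
Row 61 ED. 2 (`Theorems/F0P3cStCharTSEPInducedTraceZeroAtDatum`, `…_eq_zero_of_horocycleData`) calls §1 twice (the two special vertex types) and §2 once (the edge type) and feeds
★ 61a ED. 1 `smoothTrace_cmPrincipalSeries_epFunction_eq_zero_of_blockSums` together with ★ 5b `sum_finrank_block_eigen_eq_of_tree`.

## References
* [SchneiderStuhler1997] P. Schneider, U. Stuhler, *Representation theory and sheaves on the Bruhat–Tits building*, Publ. Math. IHÉS 85 (1997), §III.4 Lemma III.4.13, Lemma III.4.18.
* [BernsteinZelevinsky1977] I. N. Bernstein, A. V. Zelevinsky, *Induced representations of reductive 𝔭-adic groups I*, Ann. Sci. ÉNS 10 (1977), §2.3, Thm 5.2 (geometric lemma).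
* [Casselman1995] W. Casselman, *Introduction to the theory of admissible representations of `p`-adic reductive groups* (1995 notes), §3.1–§3.2, §6.3.
* [Brown1982] K. S. Brown, *Cohomology of Groups*, GTM 87 (1982), III §5–§6.
-/

set_option autoImplicit false

open scoped BigOperators Pointwise
open SimpleGraph Finset Function Module
open Literature.NumberTheory.Automorphic Literature.Combinatorics.SimpleGraph Literature.Combinatorics.SimpleGraph.OrientedIncidence

namespace Representation

section Tree

variable {k Γ V W : Type*} [Field k] [CharZero k] [Group Γ] [TopologicalSpace Γ] [IsTopologicalGroup Γ]
  [AddCommGroup V] [Module k V] [AddCommGroup W] [Module k W] {ρ : Representation k Γ V}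
variable {ι : Type*} [DecidableEq ι] {G : SimpleGraph ι} {a : Γ →* (G ≃g G)}
variable {τ : Representation k Γ (ι →₀ V)} (hτ : ∀ (g : Γ) (v : ι →₀ V), τ g v = Finsupp.mapRange (ρ g) (map_zero _) (Finsupp.equivMapDomain (a g).toEquiv v))
variable {τ₁ : Representation k Γ (G.edgeSet →₀ V)}
  (hτ₁ : ∀ (g : Γ) (c : G.edgeSet →₀ V), τ₁ g c = Finsupp.mapRange (ρ g) (map_zero _) (Finsupp.equivMapDomain (a g).mapEdgeSet c))

/-! ## §1 The vertex type -/

include hτ in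
/-- **THE BLOCKWISE MULTIPLICITY OF A VERTEX `K`-TYPE IN `Ind_P^Γ σ`, ON THE TREE** (★ row 60 with ★ (M3) and ★ (M2) plugged in).  For a vertex `x₀` with stabiliser `K` (`hK`, open),
the `K`-type `τK = ρ|_K` on `E = V^{U_{x₀}}` (`hτK`, smooth), an inducing line `σ = χH` of `P = t.P` with open kernel, trivial on `N` (`hσχ hχo hNχ hW1`), ONE (α) package
`(g, hcover, hdisj, T, hT)` at `K` with the compact torus `C ≤ M`, `C ≤ T i` (`hCM hCT hdec hC`), the horocycle vertex data `(rep₀ tr₀ …)` with `g_i · x₀ ∈ R₀` (`hr`), and the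
`χC`-eigenspace `E₀` of `C` in the Jacquet module of `C₀(X)` (`hχC hE₀`, ★ 5b's currency):
`dim_k Hom_K(V^{U_{x₀}}, (Ind_P^Γ σ)|_K) = Σ_i dim_k ([W⁰_{g_i · x₀}] ⊓ E₀)`.
[cite: SchneiderStuhler1997, §III.4 Lemma III.4.13, Lemma III.4.18] [cite: BernsteinZelevinsky1977, §2.3, Thm 5.2] [cite: Casselman1995, §3.2, §6.3] -/
theorem finrank_intertwiningMap_smoothIndRep_eq_sum_block_eigen_zeroChains
    (U : ι → Subgroup Γ) (hUa : ∀ (g : Γ) (x : ι), U (a g x) = (U x).map (MulAut.conj g).toMonoidHom)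
    (hρ : ρ.IsSmooth) (hfd : ∀ x, FiniteDimensional k (ρ.fixedPoints (U x)))
    {ρ₀ : Representation k Γ ↥(⨆ x ∈ (Set.univ : Set ι), (ρ.fixedPoints (U x)).map (Finsupp.lsingle x : V →ₗ[k] ι →₀ V))}
    (hρ₀ : ∀ (g : Γ) v, ((ρ₀ g v : _) : ι →₀ V) = τ g v)
    (t : ParabolicTriple Γ)
    -- the inducing line
    (σ : Representation k t.P W) (χH : ↥t.P →* kˣ) (hσχ : ∀ (h : t.P) (w : W), σ h w = ((χH h : kˣ) : k) • w) (hχo : IsOpen (χH.ker : Set t.P))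
    (hNχ : ∀ (n : Γ) (hn : n ∈ t.P), n ∈ t.N → χH ⟨n, hn⟩ = 1) (hW1 : finrank k W = 1)
    -- the vertex, its stabiliser, the `K`-type
    (x₀ : ι) (K : Subgroup Γ) (hK : ∀ y, y ∈ K ↔ a y x₀ = x₀) (hKo : IsOpen (K : Set Γ))
    (τK : Representation k K (ρ.fixedPoints (U x₀))) (hτK : ∀ (κ : K) (e : ρ.fixedPoints (U x₀)), ((τK κ e : ρ.fixedPoints (U x₀)) : V) = ρ (κ : Γ) e)
    (hτsm : τK.IsSmooth)
    -- (X3)(X4): one (α) double-coset package at `K`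
    {κι : Type*} [Fintype κι] (g : κι → Γ)
    (hcover : ∀ y : Γ, ∃ i, ∃ h : t.P, ∃ κ ∈ K, y = (h : Γ) * g i * κ)
    (hdisj : ∀ i j, (∃ h : t.P, ∃ κ ∈ K, g j = (h : Γ) * g i * κ) → i = j)
    (T : κι → Subgroup Γ) (hT : ∀ (i : κι) (y : Γ), y ∈ T i ↔ y ∈ t.P ∧ (g i)⁻¹ * y * g i ∈ K)
    (C : Subgroup Γ) (hCM : C ≤ t.M) (hCT : ∀ i, C ≤ T i)
    (hdec : ∀ (i : κι) (x : T i), ∃ c ∈ C.subgroupOf (T i), ∃ n ∈ t.N.subgroupOf (T i), x = c * n)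
    (hC : ∀ i, IsCompact ((C.subgroupOf (T i) : Subgroup (T i)) : Set (T i)))
    -- (X1): horocycle vertex data
    {R₀ : Set ι} (rep₀ : ι → ι) (tr₀ : ι → Γ) (htrN₀ : ∀ b, tr₀ b ∈ t.N) (htr₀ : ∀ b, a (tr₀ b) (rep₀ b) = b)
    (hrep_act₀ : ∀ n ∈ t.N, ∀ b, rep₀ (a n b) = rep₀ b) (hrep_id₀ : ∀ r ∈ R₀, rep₀ r = r) (hr : ∀ i, a (g i) x₀ ∈ R₀)
    -- (X2)∕(L2): the torus character and its eigenspace in the Jacquet module of `C₀(X)`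
    (χC : C →* kˣ) (hχC : ∀ c : C, ((χC c : kˣ) : k) = ((χH ⟨(c : Γ), t.M_le (hCM c.2)⟩ : kˣ) : k))
    {E₀ : Submodule k (t.restrict ρ₀).Coinvariants}
    (hE₀ : ∀ x, x ∈ E₀ ↔ ∀ c : C, (ρ₀.jacquetModule t ⟨c, hCM c.2⟩ : _ →ₗ[k] _) x = ((χC c : kˣ) : k) • x) :
    finrank k (IntertwiningMap τK ((smoothIndRep t.P σ).comp K.subtype)) =
      ∑ i, finrank k ↥(((((ρ.fixedPoints (U (a (g i) x₀))).map (Finsupp.lsingle (a (g i) x₀) : V →ₗ[k] ι →₀ V)).comap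
        (⨆ x ∈ (Set.univ : Set ι), (ρ.fixedPoints (U x)).map (Finsupp.lsingle x : V →ₗ[k] ι →₀ V)).subtype).map (Coinvariants.mk (t.restrict ρ₀))) ⊓ E₀) := by
  classical
  -- the action on vertices is multiplicative
  have hmul : ∀ (g₁ g₂ : Γ) (b : ι), a (g₁ * g₂) b = a g₁ (a g₂ b) := fun g₁ g₂ b => by rw [map_mul]; rfl
  have hone : ∀ b : ι, a 1 b = b := fun b => by rw [map_one]; rfl
  have hTP : ∀ i, T i ≤ t.P := fun i y hy => ((hT i y).1 hy).1
  -- elements of `T i` fix the vertex `g_i · x₀`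
  have hTfix : ∀ (i : κι) (y : Γ), y ∈ T i → a y (a (g i) x₀) = a (g i) x₀ := fun i y hy => by
    have h3 : a ((g i)⁻¹ * y * g i) x₀ = x₀ := (hK _).1 ((hT i y).1 hy).2
    calc a y (a (g i) x₀) = a (y * g i) x₀ := (hmul _ _ _).symm
      _ = a (g i * ((g i)⁻¹ * y * g i)) x₀ := by rw [mul_assoc (g i)⁻¹, mul_inv_cancel_left]
      _ = a (g i) x₀ := by rw [hmul, h3]
  -- `E′ i = V^{U_{g_i x₀}}`: the translate of `E`, `T i`-stable, finite-dimensional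
  have hE : ∀ i, (ρ.fixedPoints (U x₀)).map (ρ (g i)) = ρ.fixedPoints (U (a (g i) x₀)) := fun i => map_fixedPoints_eq_fixedPoints_act hUa (g i) x₀
  have hE'T : ∀ (i : κι), ∀ y ∈ T i, ∀ v ∈ ρ.fixedPoints (U (a (g i) x₀)), ρ y v ∈ ρ.fixedPoints (U (a (g i) x₀)) := fun i y hy v hv => by
    have h := apply_mem_fixedPoints_act hUa y hv
    rwa [hTfix i y hy] at h
  haveI : ∀ i, FiniteDimensional k (ρ.fixedPoints (U (a (g i) x₀))) := fun i => hfd _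
  haveI : FiniteDimensional k (ρ.fixedPoints (U x₀)) := hfd _
  -- `N ∩ T i ⊴ T i`; `χH` is trivial on it
  haveI hNn : ∀ i, (t.N.subgroupOf (T i)).Normal := fun i => ⟨fun n hn x => by
    rw [Subgroup.mem_subgroupOf] at hn ⊢
    rw [Subgroup.coe_mul, Subgroup.coe_mul, Subgroup.coe_inv]
    exact (Subgroup.mem_normalizer_iff.1 (t.le_normalizer (hTP i x.2)) _).1 hn⟩
  have hNχ' : ∀ (i : κι) (n : ↥(t.N.subgroupOf (T i))) (hn : ((n : T i) : Γ) ∈ t.P), χH ⟨((n : T i) : Γ), hn⟩ = 1 := fun i n hn =>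
    hNχ _ hn (Subgroup.mem_subgroupOf.1 n.2)
  -- ★ (M3): the local representation data
  obtain ⟨σc, τ', σT, σQ, χ, σtw, Eig, hσc, hτ', hσT, hWN, hσQ, hker, hχ, hsm, htw, hEig, hfdQ⟩ :=
    exists_mackeyLocalData ρ σ hρ χH hσχ hχo g T hT (fun i => ρ.fixedPoints (U (a (g i) x₀))) hE'T
      (fun i => C.subgroupOf (T i)) (fun i => t.N.subgroupOf (T i)) hNχ'
  haveI : ∀ i, FiniteDimensional k (Coinvariants ((τ' i).comp (t.N.subgroupOf (T i)).subtype)) := hfdQ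
  -- ★ (M2) §1: the `N ≤ P` dictionary for the vertex blocks of `C₀(X)`
  obtain ⟨tr', -, hact', hact1', hperm', htr', hrep_act'⟩ :=
    exists_restrict_blockData t ρ₀
      (fun x : ι => ((ρ.fixedPoints (U x)).map (Finsupp.lsingle x : V →ₗ[k] ι →₀ V)).comap
        (⨆ x ∈ (Set.univ : Set ι), (ρ.fixedPoints (U x)).map (Finsupp.lsingle x : V →ₗ[k] ι →₀ V)).subtype)
      (fun y b => a y b) hmul hone (fun y b m hm => rep_mem_zeroBlock hτ U Set.univ hUa hρ₀ y b m hm) rep₀ tr₀ htrN₀ htr₀ hrep_act₀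
  -- ★ (M2) §1: stabilisers of the representatives in `N`, and their inclusions into `T i` (L1)
  obtain ⟨Nr, hNr⟩ := exists_stabilizer_subgroups (fun (s : ↥(t.N.subgroupOf t.P)) (b : ι) => a ((s : t.P) : Γ) b) hact' hact1' (fun i => a (g i) x₀)
  have hNrfix : ∀ (i : κι) (s : ↥(t.N.subgroupOf t.P)), s ∈ Nr i → a ((s : t.P) : Γ) (a (g i) x₀) = a (g i) x₀ := fun i s hs => (hNr i s).1 hs
  have hNrT : ∀ i, ∀ s ∈ Nr i, (((s : ↥(t.N.subgroupOf t.P)) : t.P) : Γ) ∈ T i := fun i s hs => by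
    refine (hT i _).2 ⟨(s : t.P).2, (hK _).2 ?_⟩
    rw [hmul, hmul, hNrfix i s hs, ← hmul, inv_mul_cancel, hone]
  obtain ⟨φN, hφN⟩ := exists_monoidHoms_of_coe_mem Nr T hNrT
  -- ★ (M2) §2: the local models of the vertex blocks
  obtain ⟨emb, hinj, hrange, -, hemb⟩ := exists_localModels_zeroBlocks hτ U Set.univ hρ₀ (fun i => a (g i) x₀) (fun _ => Set.mem_univ _)
  -- a non-zero vector of the line `W`
  haveI : Nontrivial W := Module.nontrivial_of_finrank_eq_succ hW1
  obtain ⟨w₀, hw₀⟩ := exists_ne (0 : W)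
  -- ★ row 60
  refine finrank_intertwiningMap_smoothIndRep_eq_sum_finrank_block_eigen ρ σ τK hτK hKo hτsm hcover hdisj σc hσc T hT
    (fun i => ρ.fixedPoints (U (a (g i) x₀))) hE τ' hτ' σT hσT (fun i => C.subgroupOf (T i)) (fun i => t.N.subgroupOf (T i)) hdec hWN
    (fun i => Coinvariants.mk _) (fun i => Submodule.mkQ_surjective _) hker σQ hσQ hC χ hχ σtw hsm htw Eig hEig hW1
    (t.restrict ρ₀)
    (fun x : ι => ((ρ.fixedPoints (U x)).map (Finsupp.lsingle x : V →ₗ[k] ι →₀ V)).comap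
      (⨆ x ∈ (Set.univ : Set ι), (ρ.fixedPoints (U x)).map (Finsupp.lsingle x : V →ₗ[k] ι →₀ V)).subtype)
    (fun (s : ↥(t.N.subgroupOf t.P)) (b : ι) => a ((s : t.P) : Γ) b) (isInternal_zeroBlocks_univ U) hact' hact1' hperm'
    rep₀ tr' htr' hrep_act' hrep_id₀ (fun i => a (g i) x₀) hr emb hinj hrange Nr hNr φN ?_ ?_ ?_
    (fun i (c : C) => ⟨⟨(c : Γ), hCT i c.2⟩, Subgroup.mem_subgroupOf.2 c.2⟩) ?_ (fun c : C => (ρ₀ (c : Γ) : _ →ₗ[k] _)) ?_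
    (fun c : C => (ρ₀.jacquetModule t ⟨(c : Γ), hCM c.2⟩ : _ →ₗ[k] _)) ?_ (fun c : C => ((χC c : kˣ) : k)) ?_ hE₀
  · -- `hφN`: the inclusions land in `N ∩ T i`
    intro i s
    rw [Subgroup.mem_subgroupOf, hφN]
    exact Subgroup.mem_subgroupOf.1 (s : ↥(t.N.subgroupOf t.P)).2
  · -- `hφNsurj`: every element of `N ∩ T i` fixes `g_i · x₀`
    intro i n
    have hnP : ((n : T i) : Γ) ∈ t.P := hTP i (n : T i).2
    have hs : (⟨⟨((n : T i) : Γ), hnP⟩, Subgroup.mem_subgroupOf.2 (Subgroup.mem_subgroupOf.1 n.2)⟩ : ↥(t.N.subgroupOf t.P)) ∈ Nr i :=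
      (hNr i _).2 (hTfix i _ (n : T i).2)
    exact ⟨⟨_, hs⟩, Subtype.ext (hφN i ⟨_, hs⟩)⟩
  · -- `hembN`: the local model is `N_{r i}`-equivariant
    intro i s e
    rw [ParabolicTriple.restrict_apply]
    refine hemb i _ (hNrfix i _ s.2) e _ ?_
    rw [hτ', hφN]
  · -- `hcj`: `C → C.subgroupOf (T i)` is onto
    intro i c
    exact ⟨⟨((c : T i) : Γ), Subgroup.mem_subgroupOf.1 c.2⟩, Subtype.ext (Subtype.ext rfl)⟩
  · -- `hembT`: the local model is `C`-equivariant
    intro i c e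
    exact hemb i _ (hTfix i _ (hCT i c.2)) e _ (hτ' i _ e)
  · -- `hmkT`: the torus acts on the Jacquet module through `jacquetModule`
    intro c m
    rfl
  · -- `hχ′`: the local characters are `χH|_C = χC`
    intro i c
    have h1 : σT i ((⟨⟨(c : Γ), hCT i c.2⟩, Subgroup.mem_subgroupOf.2 c.2⟩ : ↥(C.subgroupOf (T i))) : T i) w₀ =
        σ ⟨(c : Γ), t.M_le (hCM c.2)⟩ w₀ := by rw [hσT i _ ⟨(c : Γ), t.M_le (hCM c.2)⟩ rfl]
    rw [hχ, hσχ] at h1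
    rw [hχC]
    exact smul_left_injective k hw₀ h1

/-! ## §2 The edge type -/

include hτ₁ in
/-- **THE BLOCKWISE MULTIPLICITY OF AN EDGE `K`-TYPE IN `Ind_P^Γ σ`, ON THE TREE** (★ row 60 with ★ (M3) and ★ (M2) plugged in; the edge twin of §1).  For an orientation `ω`
transported by the action (`hωa`), an edge `b₀` with stabiliser `K` (`hK`, open), the `K`-type `τK = ρ|_K` on `E = V^{U_{head b₀} ⊔ U_{tail b₀}}` (`hτK`, smooth), the inducing
line `σ = χH` (`hσχ hχo hNχ hW1`), ONE (α) package `(g, hcover, hdisj, T, hT)` at `K` with the compact torus `C` (`hCM hCT hdec hC`), the horocycle EDGE data `(rep₁ tr₁ …)` with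
`g_i · b₀ ∈ R₁` (`hr`), and the `χC`-eigenspace `E₁` of `C` in the Jacquet module of `C₁(X)` (`hχC hE₁`, ★ 5b's currency):
`dim_k Hom_K(V^{U_{b₀}}, (Ind_P^Γ σ)|_K) = Σ_i dim_k ([W¹_{g_i · b₀}] ⊓ E₁)`.
[cite: SchneiderStuhler1997, §III.4 Lemma III.4.13, Lemma III.4.18] [cite: BernsteinZelevinsky1977, §2.3, Thm 5.2] [cite: Casselman1995, §3.2, §6.3] -/
theorem finrank_intertwiningMap_smoothIndRep_eq_sum_block_eigen_oneChains
    (ω : Orientation G) (U : ι → Subgroup Γ) (hUa : ∀ (g : Γ) (x : ι), U (a g x) = (U x).map (MulAut.conj g).toMonoidHom)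
    (hωa : ∀ (g : Γ) (e : G.edgeSet), ω.head ((a g).mapEdgeSet e) = a g (ω.head e) ∧ ω.tail ((a g).mapEdgeSet e) = a g (ω.tail e))
    (hρ : ρ.IsSmooth) (hfd : ∀ e : G.edgeSet, FiniteDimensional k (ρ.fixedPoints (U (ω.head e) ⊔ U (ω.tail e))))
    {ρ₁ : Representation k Γ ↥(⨆ e ∈ {e : G.edgeSet | ω.head e ∈ (Set.univ : Set ι) ∧ ω.tail e ∈ (Set.univ : Set ι)},
      (ρ.fixedPoints (U (ω.head e) ⊔ U (ω.tail e))).map (Finsupp.lsingle e : V →ₗ[k] G.edgeSet →₀ V))}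
    (hρ₁ : ∀ (g : Γ) c, ((ρ₁ g c : _) : G.edgeSet →₀ V) = τ₁ g c)
    (t : ParabolicTriple Γ)
    -- the inducing line
    (σ : Representation k t.P W) (χH : ↥t.P →* kˣ) (hσχ : ∀ (h : t.P) (w : W), σ h w = ((χH h : kˣ) : k) • w) (hχo : IsOpen (χH.ker : Set t.P))
    (hNχ : ∀ (n : Γ) (hn : n ∈ t.P), n ∈ t.N → χH ⟨n, hn⟩ = 1) (hW1 : finrank k W = 1)
    -- the edge, its stabiliser, the `K`-type
    (b₀ : G.edgeSet) (K : Subgroup Γ) (hK : ∀ y, y ∈ K ↔ (a y).mapEdgeSet b₀ = b₀) (hKo : IsOpen (K : Set Γ))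
    (τK : Representation k K (ρ.fixedPoints (U (ω.head b₀) ⊔ U (ω.tail b₀))))
    (hτK : ∀ (κ : K) (e : ρ.fixedPoints (U (ω.head b₀) ⊔ U (ω.tail b₀))), ((τK κ e : ρ.fixedPoints (U (ω.head b₀) ⊔ U (ω.tail b₀))) : V) = ρ (κ : Γ) e)
    (hτsm : τK.IsSmooth)
    -- (X3)(X4): one (α) double-coset package at `K`
    {κι : Type*} [Fintype κι] (g : κι → Γ)
    (hcover : ∀ y : Γ, ∃ i, ∃ h : t.P, ∃ κ ∈ K, y = (h : Γ) * g i * κ)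
    (hdisj : ∀ i j, (∃ h : t.P, ∃ κ ∈ K, g j = (h : Γ) * g i * κ) → i = j)
    (T : κι → Subgroup Γ) (hT : ∀ (i : κι) (y : Γ), y ∈ T i ↔ y ∈ t.P ∧ (g i)⁻¹ * y * g i ∈ K)
    (C : Subgroup Γ) (hCM : C ≤ t.M) (hCT : ∀ i, C ≤ T i)
    (hdec : ∀ (i : κι) (x : T i), ∃ c ∈ C.subgroupOf (T i), ∃ n ∈ t.N.subgroupOf (T i), x = c * n)
    (hC : ∀ i, IsCompact ((C.subgroupOf (T i) : Subgroup (T i)) : Set (T i)))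
    -- (X1): horocycle edge data
    {R₁ : Set G.edgeSet} (rep₁ : G.edgeSet → G.edgeSet) (tr₁ : G.edgeSet → Γ) (htrN₁ : ∀ b, tr₁ b ∈ t.N) (htr₁ : ∀ b, (a (tr₁ b)).mapEdgeSet (rep₁ b) = b)
    (hrep_act₁ : ∀ n ∈ t.N, ∀ b, rep₁ ((a n).mapEdgeSet b) = rep₁ b) (hrep_id₁ : ∀ r ∈ R₁, rep₁ r = r) (hr : ∀ i, (a (g i)).mapEdgeSet b₀ ∈ R₁)
    -- (X2)∕(L2): the torus character and its eigenspace in the Jacquet module of `C₁(X)`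
    (χC : C →* kˣ) (hχC : ∀ c : C, ((χC c : kˣ) : k) = ((χH ⟨(c : Γ), t.M_le (hCM c.2)⟩ : kˣ) : k))
    {E₁ : Submodule k (t.restrict ρ₁).Coinvariants}
    (hE₁ : ∀ x, x ∈ E₁ ↔ ∀ c : C, (ρ₁.jacquetModule t ⟨c, hCM c.2⟩ : _ →ₗ[k] _) x = ((χC c : kˣ) : k) • x) :
    finrank k (IntertwiningMap τK ((smoothIndRep t.P σ).comp K.subtype)) =
      ∑ i, finrank k ↥(((((ρ.fixedPoints (U (ω.head ((a (g i)).mapEdgeSet b₀)) ⊔ U (ω.tail ((a (g i)).mapEdgeSet b₀)))).map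
          (Finsupp.lsingle ((a (g i)).mapEdgeSet b₀) : V →ₗ[k] G.edgeSet →₀ V)).comap
        (⨆ e ∈ {e : G.edgeSet | ω.head e ∈ (Set.univ : Set ι) ∧ ω.tail e ∈ (Set.univ : Set ι)},
          (ρ.fixedPoints (U (ω.head e) ⊔ U (ω.tail e))).map (Finsupp.lsingle e : V →ₗ[k] G.edgeSet →₀ V)).subtype).map (Coinvariants.mk (t.restrict ρ₁))) ⊓ E₁) := by
  classical
  -- the action on edges is multiplicative
  have hmul : ∀ (g₁ g₂ : Γ) (b : G.edgeSet), (a (g₁ * g₂)).mapEdgeSet b = (a g₁).mapEdgeSet ((a g₂).mapEdgeSet b) := fun g₁ g₂ b => mapEdgeSet_mul g₁ g₂ b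
  have hone : ∀ b : G.edgeSet, (a 1).mapEdgeSet b = b := fun b => mapEdgeSet_one b
  have hTP : ∀ i, T i ≤ t.P := fun i y hy => ((hT i y).1 hy).1
  -- elements of `T i` fix the edge `g_i · b₀`
  have hTfix : ∀ (i : κι) (y : Γ), y ∈ T i → (a y).mapEdgeSet ((a (g i)).mapEdgeSet b₀) = (a (g i)).mapEdgeSet b₀ := fun i y hy => by
    have h3 : (a ((g i)⁻¹ * y * g i)).mapEdgeSet b₀ = b₀ := (hK _).1 ((hT i y).1 hy).2
    calc (a y).mapEdgeSet ((a (g i)).mapEdgeSet b₀) = (a (y * g i)).mapEdgeSet b₀ := (hmul _ _ _).symm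
      _ = (a (g i * ((g i)⁻¹ * y * g i))).mapEdgeSet b₀ := by rw [mul_assoc (g i)⁻¹, mul_inv_cancel_left]
      _ = (a (g i)).mapEdgeSet b₀ := by rw [hmul, h3]
  -- `E′ i = V^{U_{g_i b₀}}`: the translate of `E`, `T i`-stable, finite-dimensional
  have hE : ∀ i, (ρ.fixedPoints (U (ω.head b₀) ⊔ U (ω.tail b₀))).map (ρ (g i)) =
      ρ.fixedPoints (U (ω.head ((a (g i)).mapEdgeSet b₀)) ⊔ U (ω.tail ((a (g i)).mapEdgeSet b₀))) := fun i => by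
    rw [(hωa (g i) b₀).1, (hωa (g i) b₀).2]
    exact map_fixedPoints_sup_eq_fixedPoints_act hUa (g i) (ω.head b₀) (ω.tail b₀)
  have hE'T : ∀ (i : κι), ∀ y ∈ T i, ∀ v ∈ ρ.fixedPoints (U (ω.head ((a (g i)).mapEdgeSet b₀)) ⊔ U (ω.tail ((a (g i)).mapEdgeSet b₀))),
      ρ y v ∈ ρ.fixedPoints (U (ω.head ((a (g i)).mapEdgeSet b₀)) ⊔ U (ω.tail ((a (g i)).mapEdgeSet b₀))) := fun i y hy v hv => by
    have h := apply_mem_fixedPoints_sup_act hUa y hv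
    rwa [← (hωa y _).1, ← (hωa y _).2, hTfix i y hy] at h
  haveI : ∀ i, FiniteDimensional k (ρ.fixedPoints (U (ω.head ((a (g i)).mapEdgeSet b₀)) ⊔ U (ω.tail ((a (g i)).mapEdgeSet b₀)))) := fun i => hfd _
  haveI : FiniteDimensional k (ρ.fixedPoints (U (ω.head b₀) ⊔ U (ω.tail b₀))) := hfd _
  -- `N ∩ T i ⊴ T i`; `χH` is trivial on it
  haveI hNn : ∀ i, (t.N.subgroupOf (T i)).Normal := fun i => ⟨fun n hn x => by
    rw [Subgroup.mem_subgroupOf] at hn ⊢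
    rw [Subgroup.coe_mul, Subgroup.coe_mul, Subgroup.coe_inv]
    exact (Subgroup.mem_normalizer_iff.1 (t.le_normalizer (hTP i x.2)) _).1 hn⟩
  have hNχ' : ∀ (i : κι) (n : ↥(t.N.subgroupOf (T i))) (hn : ((n : T i) : Γ) ∈ t.P), χH ⟨((n : T i) : Γ), hn⟩ = 1 := fun i n hn =>
    hNχ _ hn (Subgroup.mem_subgroupOf.1 n.2)
  -- ★ (M3): the local representation data
  obtain ⟨σc, τ', σT, σQ, χ, σtw, Eig, hσc, hτ', hσT, hWN, hσQ, hker, hχ, hsm, htw, hEig, hfdQ⟩ :=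
    exists_mackeyLocalData ρ σ hρ χH hσχ hχo g T hT (fun i => ρ.fixedPoints (U (ω.head ((a (g i)).mapEdgeSet b₀)) ⊔ U (ω.tail ((a (g i)).mapEdgeSet b₀)))) hE'T
      (fun i => C.subgroupOf (T i)) (fun i => t.N.subgroupOf (T i)) hNχ'
  haveI : ∀ i, FiniteDimensional k (Coinvariants ((τ' i).comp (t.N.subgroupOf (T i)).subtype)) := hfdQ
  -- ★ (M2) §1: the `N ≤ P` dictionary for the edge blocks of `C₁(X)`
  obtain ⟨tr', -, hact', hact1', hperm', htr', hrep_act'⟩ :=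
    exists_restrict_blockData t ρ₁
      (fun e : G.edgeSet => ((ρ.fixedPoints (U (ω.head e) ⊔ U (ω.tail e))).map (Finsupp.lsingle e : V →ₗ[k] G.edgeSet →₀ V)).comap
        (⨆ e ∈ {e : G.edgeSet | ω.head e ∈ (Set.univ : Set ι) ∧ ω.tail e ∈ (Set.univ : Set ι)},
          (ρ.fixedPoints (U (ω.head e) ⊔ U (ω.tail e))).map (Finsupp.lsingle e : V →ₗ[k] G.edgeSet →₀ V)).subtype)
      (fun y b => (a y).mapEdgeSet b) hmul hone (fun y b m hm => rep_mem_oneBlock hτ₁ ω U Set.univ hUa hωa hρ₁ y b m hm) rep₁ tr₁ htrN₁ htr₁ hrep_act₁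
  -- ★ (M2) §1: stabilisers of the representatives in `N`, and their inclusions into `T i` (L1)
  obtain ⟨Nr, hNr⟩ := exists_stabilizer_subgroups (fun (s : ↥(t.N.subgroupOf t.P)) (b : G.edgeSet) => (a ((s : t.P) : Γ)).mapEdgeSet b) hact' hact1'
    (fun i => (a (g i)).mapEdgeSet b₀)
  have hNrfix : ∀ (i : κι) (s : ↥(t.N.subgroupOf t.P)), s ∈ Nr i → (a ((s : t.P) : Γ)).mapEdgeSet ((a (g i)).mapEdgeSet b₀) = (a (g i)).mapEdgeSet b₀ :=
    fun i s hs => (hNr i s).1 hs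
  have hNrT : ∀ i, ∀ s ∈ Nr i, (((s : ↥(t.N.subgroupOf t.P)) : t.P) : Γ) ∈ T i := fun i s hs => by
    refine (hT i _).2 ⟨(s : t.P).2, (hK _).2 ?_⟩
    rw [hmul, hmul, hNrfix i s hs, ← hmul, inv_mul_cancel, hone]
  obtain ⟨φN, hφN⟩ := exists_monoidHoms_of_coe_mem Nr T hNrT
  -- ★ (M2) §3: the local models of the edge blocks
  obtain ⟨emb, hinj, hrange, -, hemb⟩ := exists_localModels_oneBlocks hτ₁ ω U Set.univ hρ₁ (fun i => (a (g i)).mapEdgeSet b₀) (fun _ => ⟨Set.mem_univ _, Set.mem_univ _⟩)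
  -- a non-zero vector of the line `W`
  haveI : Nontrivial W := Module.nontrivial_of_finrank_eq_succ hW1
  obtain ⟨w₀, hw₀⟩ := exists_ne (0 : W)
  -- ★ row 60
  refine finrank_intertwiningMap_smoothIndRep_eq_sum_finrank_block_eigen ρ σ τK hτK hKo hτsm hcover hdisj σc hσc T hT
    (fun i => ρ.fixedPoints (U (ω.head ((a (g i)).mapEdgeSet b₀)) ⊔ U (ω.tail ((a (g i)).mapEdgeSet b₀)))) hE τ' hτ' σT hσT
    (fun i => C.subgroupOf (T i)) (fun i => t.N.subgroupOf (T i)) hdec hWN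
    (fun i => Coinvariants.mk _) (fun i => Submodule.mkQ_surjective _) hker σQ hσQ hC χ hχ σtw hsm htw Eig hEig hW1
    (t.restrict ρ₁)
    (fun e : G.edgeSet => ((ρ.fixedPoints (U (ω.head e) ⊔ U (ω.tail e))).map (Finsupp.lsingle e : V →ₗ[k] G.edgeSet →₀ V)).comap
      (⨆ e ∈ {e : G.edgeSet | ω.head e ∈ (Set.univ : Set ι) ∧ ω.tail e ∈ (Set.univ : Set ι)},
        (ρ.fixedPoints (U (ω.head e) ⊔ U (ω.tail e))).map (Finsupp.lsingle e : V →ₗ[k] G.edgeSet →₀ V)).subtype)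
    (fun (s : ↥(t.N.subgroupOf t.P)) (b : G.edgeSet) => (a ((s : t.P) : Γ)).mapEdgeSet b) (isInternal_oneBlocks_univ ω U) hact' hact1' hperm'
    rep₁ tr' htr' hrep_act' hrep_id₁ (fun i => (a (g i)).mapEdgeSet b₀) hr emb hinj hrange Nr hNr φN ?_ ?_ ?_
    (fun i (c : C) => ⟨⟨(c : Γ), hCT i c.2⟩, Subgroup.mem_subgroupOf.2 c.2⟩) ?_ (fun c : C => (ρ₁ (c : Γ) : _ →ₗ[k] _)) ?_
    (fun c : C => (ρ₁.jacquetModule t ⟨(c : Γ), hCM c.2⟩ : _ →ₗ[k] _)) ?_ (fun c : C => ((χC c : kˣ) : k)) ?_ hE₁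
  · -- `hφN`
    intro i s
    rw [Subgroup.mem_subgroupOf, hφN]
    exact Subgroup.mem_subgroupOf.1 (s : ↥(t.N.subgroupOf t.P)).2
  · -- `hφNsurj`
    intro i n
    have hnP : ((n : T i) : Γ) ∈ t.P := hTP i (n : T i).2
    have hs : (⟨⟨((n : T i) : Γ), hnP⟩, Subgroup.mem_subgroupOf.2 (Subgroup.mem_subgroupOf.1 n.2)⟩ : ↥(t.N.subgroupOf t.P)) ∈ Nr i :=
      (hNr i _).2 (hTfix i _ (n : T i).2)
    exact ⟨⟨_, hs⟩, Subtype.ext (hφN i ⟨_, hs⟩)⟩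
  · -- `hembN`
    intro i s e
    rw [ParabolicTriple.restrict_apply]
    refine hemb i _ (hNrfix i _ s.2) e _ ?_
    rw [hτ', hφN]
  · -- `hcj`
    intro i c
    exact ⟨⟨((c : T i) : Γ), Subgroup.mem_subgroupOf.1 c.2⟩, Subtype.ext (Subtype.ext rfl)⟩
  · -- `hembT`
    intro i c e
    exact hemb i _ (hTfix i _ (hCT i c.2)) e _ (hτ' i _ e)
  · -- `hmkT`
    intro c m
    rfl
  · -- `hχ′`
    intro i c
    have h1 : σT i ((⟨⟨(c : Γ), hCT i c.2⟩, Subgroup.mem_subgroupOf.2 c.2⟩ : ↥(C.subgroupOf (T i))) : T i) w₀ =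
        σ ⟨(c : Γ), t.M_le (hCM c.2)⟩ w₀ := by rw [hσT i _ ⟨(c : Γ), t.M_le (hCM c.2)⟩ rfl]
    rw [hχ, hσχ] at h1
    rw [hχC]
    exact smul_left_injective k hw₀ h1

end Tree

end Representation
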